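import Summits.QuantumFields.BalabanUV.T4Continuum.Support.NE9PolydiscSchwarzPick
import Summits.QuantumFields.BalabanUV.T4Continuum.Support.NE9EarleHamiltonChain

/-!
# NE9PolydiscChain — ROUTE R4♯ «POLYDISC SCHWARZ–PICK», PART 2∕3: the chain estimate on the polydisc at the SHARP rate `θ`,
# `chainLipschitz_of_holoSelfMaps_polydisc`, and the END `NE9 ∧ FadingMemory` at constants `(1∕(1−θ²), θ)`
# (the planner kernel `t4/ideate/NE9/lens1-NE9PolydiscKernel.lean` sha16 a147eb83d7390d11, t4-ne9-idea-1 generation 5,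
# §§5–6 + §T, proofs VERBATIM — filed under the planner's OFFER (a) «→ leaf-03 (chain holder p252549): §6
# `chainLipschitz_of_holoSelfMaps_polydisc` + END as siblings of p252549's theorems» of `t4/ROUTES-NE9.md` v5 §V5; cell
# `pub-balaban`, T4-DAG §2 node U3 ∕ §6 NE9; unit `b2b-balaban-t4-ne9-formalise-leaf-03`, generation 41; Summits-side NEW
# work on the tree's R4 interface `HoloSelfMaps` ∕ `ChainLipschitz` ∕ `ne9_and_fadingMemory_of_chainLipschitz` (p252549);
# nothing of any import modified, nothing printed asserted, no named fact, 0 `def`)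

HONEST FRAMING (T4-DAG PAGE 1).  Rung (B)+1 of the FINITE-VOLUME T⁴ programme — NOT infinite volume, NOT a mass gap, NOT
the Clay problem.  NE9 (`T4OutputRate.NE9` ∧ `FadingMemory`) is a cell NEW ESTIMATE, NOT PRINTED in [I] = CMP **109**, [II] =
CMP **116**, and NOT PROVED here or anywhere: exactly as the tree's `NE9EarleHamiltonChain`, the END below concludes
`NE9 ∧ FadingMemory` FROM DISPLAYED BINDERS («NE9 ⇐ the named binders»; spine PROVED 0∕9); the θ-self-map property
`HoloSelfMaps` (route R4 steps EH1∕EH2∕EH4 = the INSTANCE — tree `NE9FutureProfileStep.holoSelfMaps_step` modulo its displayed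
(B1)–(B4), p252939 ∕ p253217; record-level dischargers = the owner's D3∕D4) is asserted of nothing.  A sharper constant inside a
conditional END is NOT progress on the estimate.  HONEST DEPENDENCY (cell line, verbatim): continuum YM on T⁴ ⇐ BetaPertH ∧
nine spine estimates (0/9 proved); BetaPertH ⇐ (D1) ∧ (D4) ∧ CAP+tail; G-an2-4 gates asym, D1 and NE2/3/4.  Nothing of
Bałaban's is constructed here; no letter of [I]∕[II] is asserted.

WHAT (all kernel-checked, 0 sorry; the planner's §-numbers kept).
* §5 THE CHAIN on `ℓ^∞(A;ℂ)`: unit ball with auxiliary parameter `θ' ∈ (θ,1]` (`norm_sub_le_of_holoChain_unit_aux`, structure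
  (a)–(d) of the tree's `EarleHamilton.norm_sub_le_of_holoChain` with PART 1's polydisc `P`-bound `norm_fderiv_apply_le` in
  place of the test-map bound), then `θ' ↓ θ` (`…_unit`), radius `r` by dilation (`…_linfty`), any `𝔛 ≃ₗᵢ[ℂ] ℓ^∞(A;ℂ)`
  (`…_polydisc`): **`‖T n x − T n y‖ ≤ (1∕(1−θ²))·θⁿ·‖x − y‖` on `B̄(0,θr)`** — rate `θ` (sharp: `θ·id`, §T) versus the
  Earle–Hamilton ∕ Harris rate `2θ∕(1+θ)` of an arbitrary complex Banach space.
* §6 ROUTE R4♯ = the tree's REGISTERED shapes at the new constants: **`chainLipschitz_of_holoSelfMaps_polydisc :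
  (e : 𝔛 ≃ₗᵢ[ℂ] ℓ^∞(A;ℂ)) → HoloSelfMaps S W r θ → ChainLipschitz S W r θ (1∕(1−θ²)) θ`** (compare p252549's
  `chainLipschitz_of_holoSelfMaps` at `(2∕(1−θ), 2θ∕(1+θ))`) and the END **`ne9_and_fadingMemory_of_holoSelfMaps_polydisc`** =
  p252549's `ne9_and_fadingMemory_of_holoSelfMaps` with binders VERBATIM (same order) plus the ONE structural datum `e`:
  `NE9 E W κ (prodModuli (cR·(1∕(1−θ²))·ℓ) (fun _ ↦ θ)) ∧ FadingMemory (cR·(1∕(1−θ²))·ℓ∕θ) θ (…)` (through p252549's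
  `ne9_and_fadingMemory_of_chainLipschitz`, which takes any `(Cc, k)`).
* §T sanity arithmetic (pure numbers): `θ < 2θ∕(1+θ)`, `1∕(1−θ²) < 2∕(1−θ)`; print-letter slack `θ = 15∕26` ⇒ rate `15∕26` vs
  `30∕41`, prefactor `676∕451` vs `52∕11` (the planner's READING of [II] pp. 8, 21 — NOT certified, asserted nowhere);
  sharpness of the rate (`θ·id`).
USE.  The drop-in on K2♭'s ambient state space `ℓ^∞(B₁;ℂ) × (Idx W →ᵇ ℓ^∞(ι;ℂ))` (no `e` argument) is PART 3
`NE9StateLinftyEquiv.ne9_and_fadingMemory_of_holoSelfMaps_state`; consumers announced on the journal: leaf-04's docking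
`NE9FutureProfileEnd…_polydisc ∕ _SP` (F-ne9leaf04g46-1) and the owner's END OF RECORD (rate `2θ∕(1+θ) ↦ θ` by feeding the
generic `NE9FutureProfileEnd.ne9_and_fadingMemory_futureInfluence`'s `hchain` slot with `chainLipschitz_of_holoSelfMaps_polydisc`
instead of `chainLipschitz_of_holoSelfMaps`, hypotheses unchanged — the owner's choice).
DISGUISE TEST: no inequality of the series; not NE9 for Bałaban's terms; no Bałaban object; 0 sorry; no named fact; nothing
printed asserted.  What route R4∕R4♯ still needs is UNCHANGED by this file: the instance (B1)–(B4) at the class of record,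
W1 = (D1), (R-1a), the room N2 read as a slack inequality.

References: [FV1980] T. Franzoni, E. Vesentini, North-Holland Math. Studies 40 (1980), ch. V §5; [Harris1979] L. A. Harris,
North-Holland Math. Studies 34 (1979) 345–406; [EH1970] C. J. Earle, R. S. Hamilton, Proc. Sympos. Pure Math. XVI (1970)
61–65; [Balaban1988RG2Cluster] T. Bałaban, CMP **116** (1988) 1–22, pp. 8, 20 (2.38), 21 (TYPES ∕ loci only; nothing
asserted).
-/

noncomputable section

namespace Summit.QuantumFields.BalabanUV.T4Continuum.NE9PolydiscChain

open Metric Set Filter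
open scoped Topology ENNReal
open Summit.QuantumFields.BalabanUV.T4Continuum.NE9PolydiscSchwarzPick (evalCLM_apply norm_coordFn_le
  norm_fderiv_apply_le)
open Summit.QuantumFields.BalabanUV.T4Continuum.NE9EarleHamiltonChain (evol evol_of_le evol_succ_apply HoloSelfMaps
  ChainLipschitz ne9_and_fadingMemory_of_chainLipschitz)
open Literature.MathematicalPhysics.QuantumFieldTheory.Balaban1983to89.T4OutputRate
open Literature.MathematicalPhysics.QuantumFieldTheory.Balaban1983to89.T4HistoryLipschitzRecursion (prodModuli)

variable {A : Type*}

/-! ## §5 The chain estimate on the polydisc -/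

/-- THE CHAIN on `ℓ^∞(A;ℂ)`, unit ball, auxiliary parameter `θ' ∈ (θ,1]`: composites of holomorphic maps
`B(0,1) → B̄(0,θ)` are `(1/(1−θ²))·θ'ⁿ`-Lipschitz on `B̄(0,θ)` (structure (a)–(d) of the tree's
`EarleHamilton.norm_sub_le_of_holoChain`, with the polydisc `P`-bound in place of the test-map bound). [folklore] -/
theorem norm_sub_le_of_holoChain_unit_aux {θ θ' : ℝ} (hθ0 : 0 < θ) (hθθ' : θ < θ') (hθ'1 : θ' ≤ 1)
    {f : ℕ → lp (fun _ : A => ℂ) ∞ → lp (fun _ : A => ℂ) ∞}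
    (hfd : ∀ n, DifferentiableOn ℂ (f n) (ball (0 : lp (fun _ : A => ℂ) ∞) 1))
    (hfm : ∀ n, MapsTo (f n) (ball (0 : lp (fun _ : A => ℂ) ∞) 1) (closedBall 0 θ))
    {T : ℕ → lp (fun _ : A => ℂ) ∞ → lp (fun _ : A => ℂ) ∞} (hT0 : T 0 = id)
    (hT : ∀ n, T (n + 1) = f n ∘ T n) (n : ℕ) {x y : lp (fun _ : A => ℂ) ∞}
    (hx : x ∈ closedBall (0 : lp (fun _ : A => ℂ) ∞) θ) (hy : y ∈ closedBall (0 : lp (fun _ : A => ℂ) ∞) θ) :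
    ‖T n x - T n y‖ ≤ 1 / (1 - θ ^ 2) * θ' ^ n * ‖x - y‖ := by
  have hθ1 : θ < 1 := lt_of_lt_of_le hθθ' hθ'1
  have hθ'0 : 0 < θ' := hθ0.trans hθθ'
  have h1θ : 0 < 1 - θ ^ 2 := by nlinarith
  have hsub : closedBall (0 : lp (fun _ : A => ℂ) ∞) θ ⊆ ball 0 1 := closedBall_subset_ball hθ1
  -- (a) the composites keep the inner ball
  have hmem : ∀ n, ∀ z ∈ closedBall (0 : lp (fun _ : A => ℂ) ∞) θ,
      T n z ∈ closedBall (0 : lp (fun _ : A => ℂ) ∞) θ := by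
    intro n
    induction n with
    | zero => intro z hz; simpa [hT0] using hz
    | succ n ih => intro z hz; rw [hT n]; exact hfm n (hsub (ih z hz))
  -- (b) derivative of the composite + transfer of the polydisc bound along the chain
  have hder : ∀ n, ∀ z ∈ closedBall (0 : lp (fun _ : A => ℂ) ∞) θ,
      HasFDerivAt (T n) (fderiv ℂ (T n) z) z ∧
      ∀ (w : lp (fun _ : A => ℂ) ∞) (β : A),
        ‖(fderiv ℂ (T n) z w) β‖ ≤ θ' ^ n * (‖w‖ / (1 - θ ^ 2)) * (1 - ‖(T n z) β‖ ^ 2) := by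
    intro n
    induction n with
    | zero =>
      intro z hz
      have hz' : ‖z‖ ≤ θ := mem_closedBall_zero_iff.1 hz
      refine ⟨?_, ?_⟩
      · rw [hT0, fderiv_id]; exact hasFDerivAt_id z
      · intro w β
        rw [hT0, fderiv_id]
        simp only [ContinuousLinearMap.coe_id', id_eq, pow_zero, one_mul]
        have hzβ : ‖z β‖ ≤ θ := (norm_coordFn_le z β).trans hz'
        have h1 : 1 - θ ^ 2 ≤ 1 - ‖z β‖ ^ 2 := by nlinarith [norm_nonneg (z β)]
        calc ‖w β‖ ≤ ‖w‖ := norm_coordFn_le w β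
          _ = ‖w‖ / (1 - θ ^ 2) * (1 - θ ^ 2) := (div_mul_cancel₀ _ h1θ.ne').symm
          _ ≤ ‖w‖ / (1 - θ ^ 2) * (1 - ‖z β‖ ^ 2) :=
            mul_le_mul_of_nonneg_left h1 (div_nonneg (norm_nonneg w) h1θ.le)
    | succ n ih =>
      intro z hz
      obtain ⟨hTn, hbound⟩ := ih z hz
      have hTnz : T n z ∈ ball (0 : lp (fun _ : A => ℂ) ∞) 1 := hsub (hmem n z hz)
      have hfn : HasFDerivAt (f n) (fderiv ℂ (f n) (T n z)) (T n z) :=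
        ((hfd n).differentiableAt (isOpen_ball.mem_nhds hTnz)).hasFDerivAt
      have hcomp : HasFDerivAt (T (n + 1)) ((fderiv ℂ (f n) (T n z)).comp (fderiv ℂ (T n) z)) z := by
        rw [hT n]; exact hfn.comp z hTn
      refine ⟨hcomp.differentiableAt.hasFDerivAt, ?_⟩
      intro w β
      have hTsucc : T (n + 1) z = f n (T n z) := by rw [hT n]; rfl
      rw [hcomp.fderiv, ContinuousLinearMap.comp_apply, hTsucc]
      have hC : 0 ≤ θ' ^ n * (‖w‖ / (1 - θ ^ 2)) :=
        mul_nonneg (pow_nonneg hθ'0.le n) (div_nonneg (norm_nonneg w) h1θ.le)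
      have key := norm_fderiv_apply_le (lp.evalCLM ℂ (fun _ : A => ℂ) ∞ β) (fun u => norm_coordFn_le u β) hθ0.le
        hθθ' hθ'1 (hfd n) (hfm n) hTnz (fderiv ℂ (T n) z w) hC (fun α => hbound w α)
      simp only [evalCLM_apply] at key
      calc ‖(fderiv ℂ (f n) (T n z) (fderiv ℂ (T n) z w)) β‖
          ≤ θ' * (θ' ^ n * (‖w‖ / (1 - θ ^ 2))) * (1 - ‖(f n (T n z)) β‖ ^ 2) := key
        _ = θ' ^ (n + 1) * (‖w‖ / (1 - θ ^ 2)) * (1 - ‖(f n (T n z)) β‖ ^ 2) := by rw [pow_succ]; ring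
  -- (c) operator-norm bound of the derivative on the inner ball
  have hop : ∀ z ∈ closedBall (0 : lp (fun _ : A => ℂ) ∞) θ, ‖fderiv ℂ (T n) z‖ ≤ 1 / (1 - θ ^ 2) * θ' ^ n := by
    intro z hz
    obtain ⟨-, hbound⟩ := hder n z hz
    have hK : 0 ≤ 1 / (1 - θ ^ 2) * θ' ^ n := mul_nonneg (one_div_nonneg.2 h1θ.le) (pow_nonneg hθ'0.le n)
    refine ContinuousLinearMap.opNorm_le_bound _ hK fun w => ?_
    have hCw : 0 ≤ θ' ^ n * (‖w‖ / (1 - θ ^ 2)) :=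
      mul_nonneg (pow_nonneg hθ'0.le n) (div_nonneg (norm_nonneg w) h1θ.le)
    have hle : ∀ β, ‖(fderiv ℂ (T n) z w) β‖ ≤ θ' ^ n * (‖w‖ / (1 - θ ^ 2)) := fun β => by
      have h1 : 1 - ‖(T n z) β‖ ^ 2 ≤ 1 := by nlinarith [norm_nonneg ((T n z) β)]
      calc ‖(fderiv ℂ (T n) z w) β‖ ≤ θ' ^ n * (‖w‖ / (1 - θ ^ 2)) * (1 - ‖(T n z) β‖ ^ 2) := hbound w β
        _ ≤ θ' ^ n * (‖w‖ / (1 - θ ^ 2)) * 1 := mul_le_mul_of_nonneg_left h1 hCw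
        _ = θ' ^ n * (‖w‖ / (1 - θ ^ 2)) := mul_one _
    calc ‖fderiv ℂ (T n) z w‖ ≤ θ' ^ n * (‖w‖ / (1 - θ ^ 2)) := lp.norm_le_of_forall_le hCw hle
      _ = 1 / (1 - θ ^ 2) * θ' ^ n * ‖w‖ := by ring
  -- (d) mean-value inequality on the convex inner ball
  exact (convex_closedBall (0 : lp (fun _ : A => ℂ) ∞) θ).norm_image_sub_le_of_norm_hasFDerivWithin_le
    (f := T n) (f' := fun z => fderiv ℂ (T n) z) (fun z hz => (hder n z hz).1.hasFDerivWithinAt) hop hy hx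

/-- THE CHAIN on `ℓ^∞(A;ℂ)`, unit ball, SHARP RATE: `‖T n x − T n y‖ ≤ (1/(1−θ²))·θⁿ·‖x − y‖` on `B̄(0,θ)`
(the previous lemma and `θ' ↓ θ`). [folklore] -/
theorem norm_sub_le_of_holoChain_unit {θ : ℝ} (hθ0 : 0 < θ) (hθ1 : θ < 1)
    {f : ℕ → lp (fun _ : A => ℂ) ∞ → lp (fun _ : A => ℂ) ∞}
    (hfd : ∀ n, DifferentiableOn ℂ (f n) (ball (0 : lp (fun _ : A => ℂ) ∞) 1))
    (hfm : ∀ n, MapsTo (f n) (ball (0 : lp (fun _ : A => ℂ) ∞) 1) (closedBall 0 θ))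
    {T : ℕ → lp (fun _ : A => ℂ) ∞ → lp (fun _ : A => ℂ) ∞} (hT0 : T 0 = id)
    (hT : ∀ n, T (n + 1) = f n ∘ T n) (n : ℕ) {x y : lp (fun _ : A => ℂ) ∞}
    (hx : x ∈ closedBall (0 : lp (fun _ : A => ℂ) ∞) θ) (hy : y ∈ closedBall (0 : lp (fun _ : A => ℂ) ∞) θ) :
    ‖T n x - T n y‖ ≤ 1 / (1 - θ ^ 2) * θ ^ n * ‖x - y‖ := by
  have h : ∀ θ', θ < θ' → θ' ≤ 1 → ‖T n x - T n y‖ ≤ 1 / (1 - θ ^ 2) * θ' ^ n * ‖x - y‖ :=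
    fun θ' h1 h2 => norm_sub_le_of_holoChain_unit_aux hθ0 h1 h2 hfd hfm hT0 hT n hx hy
  have hcont : Tendsto (fun θ' : ℝ => 1 / (1 - θ ^ 2) * θ' ^ n * ‖x - y‖) (𝓝[>] θ)
      (𝓝 (1 / (1 - θ ^ 2) * θ ^ n * ‖x - y‖)) :=
    (((continuous_const.mul (continuous_pow n)).mul continuous_const).tendsto θ).mono_left nhdsWithin_le_nhds
  have hev : ∀ᶠ θ' in 𝓝[>] θ, ‖T n x - T n y‖ ≤ 1 / (1 - θ ^ 2) * θ' ^ n * ‖x - y‖ := by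
    filter_upwards [Ioo_mem_nhdsGT hθ1] with θ' hθ' using h θ' hθ'.1 hθ'.2.le
  exact ge_of_tendsto hcont hev

/-- THE CHAIN on `ℓ^∞(A;ℂ)`, ball of radius `r` (by dilation): holomorphic maps `B(0,r) → B̄(0,θr)` compose to
`(1/(1−θ²))·θⁿ`-Lipschitz maps of `B̄(0,θr)`. [folklore] -/
theorem norm_sub_le_of_holoChain_linfty {r θ : ℝ} (hr : 0 < r) (hθ0 : 0 < θ) (hθ1 : θ < 1)
    {f : ℕ → lp (fun _ : A => ℂ) ∞ → lp (fun _ : A => ℂ) ∞}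
    (hfd : ∀ n, DifferentiableOn ℂ (f n) (ball (0 : lp (fun _ : A => ℂ) ∞) r))
    (hfm : ∀ n, MapsTo (f n) (ball (0 : lp (fun _ : A => ℂ) ∞) r) (closedBall 0 (θ * r)))
    {T : ℕ → lp (fun _ : A => ℂ) ∞ → lp (fun _ : A => ℂ) ∞} (hT0 : T 0 = id)
    (hT : ∀ n, T (n + 1) = f n ∘ T n) (n : ℕ) {x y : lp (fun _ : A => ℂ) ∞}
    (hx : x ∈ closedBall (0 : lp (fun _ : A => ℂ) ∞) (θ * r))
    (hy : y ∈ closedBall (0 : lp (fun _ : A => ℂ) ∞) (θ * r)) :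
    ‖T n x - T n y‖ ≤ 1 / (1 - θ ^ 2) * θ ^ n * ‖x - y‖ := by
  have hr0 : (r : ℂ) ≠ 0 := Complex.ofReal_ne_zero.2 hr.ne'
  have hnr : ∀ z : lp (fun _ : A => ℂ) ∞, ‖(r : ℂ) • z‖ = r * ‖z‖ := fun z => by
    rw [norm_smul, Complex.norm_of_nonneg hr.le]
  have hnr' : ∀ z : lp (fun _ : A => ℂ) ∞, ‖(r : ℂ)⁻¹ • z‖ = r⁻¹ * ‖z‖ := fun z => by
    rw [norm_smul, norm_inv, Complex.norm_of_nonneg hr.le]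
  -- the conjugated chain on the unit ball
  set g : ℕ → lp (fun _ : A => ℂ) ∞ → lp (fun _ : A => ℂ) ∞ :=
    fun n z => (r : ℂ)⁻¹ • f n ((r : ℂ) • z) with hg
  set U : ℕ → lp (fun _ : A => ℂ) ∞ → lp (fun _ : A => ℂ) ∞ :=
    fun n z => (r : ℂ)⁻¹ • T n ((r : ℂ) • z) with hU
  have hU0 : U 0 = id := by
    funext z
    show (r : ℂ)⁻¹ • T 0 ((r : ℂ) • z) = z
    rw [hT0]
    show (r : ℂ)⁻¹ • ((r : ℂ) • z) = z
    rw [smul_smul, inv_mul_cancel₀ hr0, one_smul]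
  have hUs : ∀ n, U (n + 1) = g n ∘ U n := by
    intro n; funext z
    show (r : ℂ)⁻¹ • T (n + 1) ((r : ℂ) • z) =
      (r : ℂ)⁻¹ • f n ((r : ℂ) • ((r : ℂ)⁻¹ • T n ((r : ℂ) • z)))
    rw [hT n, Function.comp_apply, smul_smul, mul_inv_cancel₀ hr0, one_smul]
  have hball : MapsTo (fun z : lp (fun _ : A => ℂ) ∞ => (r : ℂ) • z) (ball 0 1) (ball 0 r) := by
    intro z hz
    rw [mem_ball_zero_iff] at hz ⊢
    rw [hnr]; nlinarith
  have hgd : ∀ n, DifferentiableOn ℂ (g n) (ball (0 : lp (fun _ : A => ℂ) ∞) 1) := fun n =>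
    ((hfd n).comp ((differentiable_id.const_smul (r : ℂ)).differentiableOn) hball).const_smul ((r : ℂ)⁻¹)
  have hgm : ∀ n, MapsTo (g n) (ball (0 : lp (fun _ : A => ℂ) ∞) 1) (closedBall 0 θ) := by
    intro n z hz
    have h := hfm n (hball hz)
    rw [mem_closedBall_zero_iff] at h ⊢
    show ‖(r : ℂ)⁻¹ • f n ((r : ℂ) • z)‖ ≤ θ
    rw [hnr']
    calc r⁻¹ * ‖f n ((r : ℂ) • z)‖ ≤ r⁻¹ * (θ * r) := mul_le_mul_of_nonneg_left h (inv_nonneg.2 hr.le)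
      _ = θ := by field_simp
  have hin : ∀ z ∈ closedBall (0 : lp (fun _ : A => ℂ) ∞) (θ * r),
      (r : ℂ)⁻¹ • z ∈ closedBall (0 : lp (fun _ : A => ℂ) ∞) θ := by
    intro z hz
    rw [mem_closedBall_zero_iff] at hz ⊢
    rw [hnr']
    calc r⁻¹ * ‖z‖ ≤ r⁻¹ * (θ * r) := mul_le_mul_of_nonneg_left hz (inv_nonneg.2 hr.le)
      _ = θ := by field_simp
  have key := norm_sub_le_of_holoChain_unit hθ0 hθ1 hgd hgm hU0 hUs n (hin x hx) (hin y hy)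
  have h1 : U n ((r : ℂ)⁻¹ • x) - U n ((r : ℂ)⁻¹ • y) = (r : ℂ)⁻¹ • (T n x - T n y) := by
    show (r : ℂ)⁻¹ • T n ((r : ℂ) • ((r : ℂ)⁻¹ • x)) - (r : ℂ)⁻¹ • T n ((r : ℂ) • ((r : ℂ)⁻¹ • y)) = _
    rw [smul_smul, smul_smul, mul_inv_cancel₀ hr0, one_smul, one_smul, smul_sub]
  have h2 : (r : ℂ)⁻¹ • x - (r : ℂ)⁻¹ • y = (r : ℂ)⁻¹ • (x - y) := (smul_sub _ _ _).symm
  rw [h1, h2, hnr', hnr'] at key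
  have key' : r⁻¹ * ‖T n x - T n y‖ ≤ r⁻¹ * (1 / (1 - θ ^ 2) * θ ^ n * ‖x - y‖) := by
    calc r⁻¹ * ‖T n x - T n y‖ ≤ 1 / (1 - θ ^ 2) * θ ^ n * (r⁻¹ * ‖x - y‖) := key
      _ = r⁻¹ * (1 / (1 - θ ^ 2) * θ ^ n * ‖x - y‖) := by ring
  exact le_of_mul_le_mul_left key' (inv_pos.2 hr)

/-- **THE POLYDISC CHAIN ESTIMATE** (route R4♯'s kernel): in any complex Banach space ISOMETRIC TO `ℓ^∞(A;ℂ)`, holomorphic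
maps `B(0,r) → B̄(0,θr)` compose to `(1/(1−θ²))·θⁿ`-Lipschitz maps of the inner ball `B̄(0,θr)` — rate `θ` (sharp:
`θ·id`), versus the Earle–Hamilton∕Harris rate `2θ/(1+θ)` of an arbitrary Banach space (tree
`EarleHamilton.norm_sub_le_of_holoChain`). [folklore; FV1980; Harris1979] -/
theorem norm_sub_le_of_holoChain_polydisc {𝔛 : Type*} [NormedAddCommGroup 𝔛] [NormedSpace ℂ 𝔛]
    (e : 𝔛 ≃ₗᵢ[ℂ] lp (fun _ : A => ℂ) ∞) {r θ : ℝ} (hr : 0 < r) (hθ0 : 0 < θ) (hθ1 : θ < 1)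
    {f : ℕ → 𝔛 → 𝔛} (hfd : ∀ n, DifferentiableOn ℂ (f n) (ball (0 : 𝔛) r))
    (hfm : ∀ n, MapsTo (f n) (ball (0 : 𝔛) r) (closedBall (0 : 𝔛) (θ * r)))
    {T : ℕ → 𝔛 → 𝔛} (hT0 : T 0 = id) (hT : ∀ n, T (n + 1) = f n ∘ T n) (n : ℕ)
    {x y : 𝔛} (hx : x ∈ closedBall (0 : 𝔛) (θ * r)) (hy : y ∈ closedBall (0 : 𝔛) (θ * r)) :
    ‖T n x - T n y‖ ≤ 1 / (1 - θ ^ 2) * θ ^ n * ‖x - y‖ := by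
  set g : ℕ → lp (fun _ : A => ℂ) ∞ → lp (fun _ : A => ℂ) ∞ := fun n z => e (f n (e.symm z)) with hg
  set U : ℕ → lp (fun _ : A => ℂ) ∞ → lp (fun _ : A => ℂ) ∞ := fun n z => e (T n (e.symm z)) with hU
  have hU0 : U 0 = id := by funext z; simp [hU, hT0]
  have hUs : ∀ n, U (n + 1) = g n ∘ U n := by intro n; funext z; simp [hU, hg, hT n]
  have hball : MapsTo e.symm (ball (0 : lp (fun _ : A => ℂ) ∞) r) (ball (0 : 𝔛) r) := fun z hz => by
    rw [mem_ball_zero_iff] at hz ⊢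
    rwa [e.symm.norm_map]
  have hgd : ∀ n, DifferentiableOn ℂ (g n) (ball (0 : lp (fun _ : A => ℂ) ∞) r) := fun n =>
    e.differentiable.comp_differentiableOn ((hfd n).comp e.symm.differentiable.differentiableOn hball)
  have hgm : ∀ n, MapsTo (g n) (ball (0 : lp (fun _ : A => ℂ) ∞) r) (closedBall 0 (θ * r)) := by
    intro n z hz
    have h := hfm n (hball hz)
    rw [mem_closedBall_zero_iff] at h ⊢
    show ‖e (f n (e.symm z))‖ ≤ θ * r
    rwa [e.norm_map]
  have hin : ∀ z ∈ closedBall (0 : 𝔛) (θ * r), e z ∈ closedBall (0 : lp (fun _ : A => ℂ) ∞) (θ * r) := by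
    intro z hz
    rw [mem_closedBall_zero_iff] at hz ⊢
    rwa [e.norm_map]
  have key := norm_sub_le_of_holoChain_linfty hr hθ0 hθ1 hgd hgm hU0 hUs n (hin x hx) (hin y hy)
  have h1 : U n (e x) - U n (e y) = e (T n x - T n y) := by simp [hU]
  have h2 : e x - e y = e (x - y) := (map_sub e x y).symm
  rwa [h1, h2, e.norm_map, e.norm_map] at key

/-! ## §6 Route R4♯: the tree's registered shapes at the sharp constants -/

/-- **ROUTE R4♯ KERNEL**: under the tree's `HoloSelfMaps S W r θ` and a polydisc structure `e : 𝔛 ≃ₗᵢ[ℂ] ℓ^∞(A;ℂ)` on the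
state space, the tree's `ChainLipschitz` holds with constants `(1/(1−θ²), θ)` — compare the tree's
`chainLipschitz_of_holoSelfMaps` with `(2/(1−θ), 2θ/(1+θ))`. [folklore] -/
theorem chainLipschitz_of_holoSelfMaps_polydisc {𝔛 : Type*} [NormedAddCommGroup 𝔛] [NormedSpace ℂ 𝔛]
    (e : 𝔛 ≃ₗᵢ[ℂ] lp (fun _ : A => ℂ) ∞) {S : ℕ → (ℕ → ℝ) → 𝔛 → 𝔛} {W : Set (ℕ → ℝ)} {r θ : ℝ}
    (hr : 0 < r) (hθ0 : 0 < θ) (hθ1 : θ < 1) (hS : HoloSelfMaps S W r θ) :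
    ChainLipschitz S W r θ (1 / (1 - θ ^ 2)) θ := by
  intro g hg i K x hx y hy
  rcases le_or_gt K i with hKi | hiK
  · rw [evol_of_le hKi, Nat.sub_eq_zero_of_le hKi, pow_zero, mul_one, id, id]
    have h1θ : 0 < 1 - θ ^ 2 := by nlinarith
    have h1 : (1 : ℝ) ≤ 1 / (1 - θ ^ 2) := by
      rw [le_div_iff₀ h1θ]; nlinarith
    nlinarith [norm_nonneg (x - y)]
  · obtain ⟨n, rfl⟩ := Nat.exists_eq_add_of_lt hiK
    have key := norm_sub_le_of_holoChain_polydisc e hr hθ0 hθ1 (f := fun m => S (i + m) g)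
      (T := fun m => evol (fun j => S j g) i (i + m)) (fun m => (hS (i + m) g hg).1) (fun m => (hS (i + m) g hg).2)
      (evol_of_le le_rfl) (fun m => funext fun z => evol_succ_apply (Nat.le_add_right i m) z) (n + 1) hx hy
    have hsub : i + n + 1 - i = n + 1 := by omega
    rw [hsub]
    exact key

/-- **ROUTE R4♯ END** — the tree's END `ne9_and_fadingMemory_of_holoSelfMaps` VERBATIM (same binders, same order) plus the
ONE structural datum `e : 𝔛 ≃ₗᵢ[ℂ] ℓ^∞(A;ℂ)`, at the SHARP constants: `NE9 E W κ (prodModuli (cR·(1/(1−θ²))·ℓ) (fun _ ↦ θ))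
∧ FadingMemory (cR·(1/(1−θ²))·ℓ/θ) θ (…)` — rate `θ` instead of `2θ/(1+θ)`, prefactor `1/(1−θ²)` instead of `2/(1−θ)`.
HONEST: concludes `NE9 ∧ FadingMemory` FROM DISPLAYED BINDERS (`HoloSelfMaps` = the instance's burden, asserted of nothing);
NE9 NOT PRINTED, NOT PROVED; spine 0∕9. [folklore] -/
theorem ne9_and_fadingMemory_of_holoSelfMaps_polydisc {𝔛 : Type*} [NormedAddCommGroup 𝔛] [NormedSpace ℂ 𝔛]
    (e : 𝔛 ≃ₗᵢ[ℂ] lp (fun _ : A => ℂ) ∞)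
    {C : Carriers} {Bg : Type} (E : Functional C Bg) (W : Set (ℕ → ℝ))
    (S : ℕ → (ℕ → ℝ) → 𝔛 → 𝔛) (emb : ℕ → (ℕ → ℝ) → 𝔛) {κ r θ ℓ cR : ℝ} {lam : ℕ → ℝ}
    (hr : 0 < r) (hθ0 : 0 < θ) (hθ1 : θ < 1) (hℓ : 0 ≤ ℓ) (hcR : 0 ≤ cR)
    (hS : HoloSelfMaps S W r θ)
    (hfac : ∀ j, ∀ g ∈ W, emb (j + 1) g = S j g (emb j g))
    (h0 : ∀ g ∈ W, ∀ g' ∈ W, emb 0 g = emb 0 g')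
    (h0in : ∀ g ∈ W, emb 0 g ∈ closedBall (0 : 𝔛) (θ * r))
    (hlast : ∀ j, ∀ g ∈ W, ∀ g' ∈ W, ‖S j g (emb j g) - S j g' (emb j g)‖ ≤ lam j * |g j - g' j|)
    (hlam : ∀ j, lam j ≤ ℓ)
    (hread : ∀ g ∈ W, ∀ g' ∈ W, ∀ (U : Bg) (X : C.Dom),
      |E g U X - E g' U X| ≤ Real.exp (-(κ * C.d X)) * (cR * ‖emb (C.scale X) g - emb (C.scale X) g'‖)) :
    NE9 E W κ (prodModuli (cR * (1 / (1 - θ ^ 2)) * ℓ) fun _ => θ) ∧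
      FadingMemory (cR * (1 / (1 - θ ^ 2)) * ℓ / θ) θ (prodModuli (cR * (1 / (1 - θ ^ 2)) * ℓ) fun _ => θ) :=
  ne9_and_fadingMemory_of_chainLipschitz E W S emb hr hθ1 (one_div_nonneg.2 (by nlinarith)) hθ0 hℓ hcR
    (fun j g hg => (hS j g hg).2) (chainLipschitz_of_holoSelfMaps_polydisc e hr hθ0 hθ1 hS) hfac h0 h0in hlast hlam hread

/-! ## §T Sanity arithmetic (pure numbers; print-letter values are the planner's READING of [II], asserted nowhere) -/

/-- The sharp rate beats the Earle–Hamilton∕Harris rate for every `θ ∈ (0,1)`: `θ < 2θ/(1+θ)`. -/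
example {θ : ℝ} (hθ0 : 0 < θ) (hθ1 : θ < 1) : θ < 2 * θ / (1 + θ) := by
  rw [lt_div_iff₀ (by linarith)]; nlinarith

/-- … and the prefactor too: `1/(1−θ²) < 2/(1−θ)`. -/
example {θ : ℝ} (hθ0 : 0 < θ) (hθ1 : θ < 1) : 1 / (1 - θ ^ 2) < 2 / (1 - θ) := by
  rw [div_lt_div_iff₀ (by nlinarith) (by linarith)]; nlinarith

/-- Print-letter slack `s_box = 24/13` (`θ = 1/13 + 1/2 = 15/26`): rate `15/26 ≈ 0.577` versus `30/41 ≈ 0.732`;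
prefactor `676/451 ≈ 1.50` versus `52/11 ≈ 4.73`. -/
example : 2 * ((15 : ℝ) / 26) / (1 + 15 / 26) = 30 / 41 ∧ (1 : ℝ) / (1 - (15 / 26) ^ 2) = 676 / 451 ∧
    (2 : ℝ) / (1 - 15 / 26) = 52 / 11 := by norm_num

/-- SHARPNESS of the rate (one coordinate suffices): `f = θ·id` maps `B(0,1)` into `B̄(0,θ)` and its composites
`T n = θⁿ·id` are exactly `θⁿ`-Lipschitz — no rate below `θ` is possible under `HoloSelfMaps` alone. -/
example {θ : ℝ} (n : ℕ) (x y : ℂ) : ‖(θ : ℂ) ^ n * x - (θ : ℂ) ^ n * y‖ = |θ| ^ n * ‖x - y‖ := by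
  rw [← mul_sub, norm_mul, norm_pow, Complex.norm_real, Real.norm_eq_abs]

end Summit.QuantumFields.BalabanUV.T4Continuum.NE9PolydiscChain

end
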